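import Summits.ResolutionOfSingularities.ResolutionOfSingularities.Theorems.FrobeniusLadderFInjectiveMacaulayficationTauFloorInputLegal
import Summits.ResolutionOfSingularities.ResolutionOfSingularities.Theorems.FrobeniusLadderFInjectiveMacaulayficationAffineBlowupStalkNotClause
import Summits.ResolutionOfSingularities.ResolutionOfSingularities.Theorems.FrobeniusLadderFInjectiveMacaulayficationTauFloorP2d4CRow
import Literature.AlgebraicGeometry.Resolution.AffineBlowupResolutionCriterion
import HarnessLib

/-!
# F4POS-1 (e): THE τ-FLOOR `S′ = Bl_τ X → Spec 𝒪_{X,v}` IS NOT F(4)-iso — it has a NON-FULL stalk over the closed point — and ROW #1 as ONE theorem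
# (crux `FInjectiveMacaulayfication` stmt-ResolutionOfSingularities-15315, chain w45a; seat res-L1-w45a-stub-1 g10, sequel to p624171)

[OURS · L1 W4.5a] Support file (`--supports stmt-ResolutionOfSingularities-15315 --as helper`); replaces the role of NO printed item; NOT a statement of any
manuscript; def-free; UNCONDITIONAL. AI-written (AI review is weaker than expert review).

WHAT. Lettering of `TauFloorInputLegal` (`X = Spec A₀`, `A₀ = k[X0..X4]/(f)`, `f = X4² + X0⁴X4 + X1³ + X2³ + X3³`, `char k = 2`, `v` the vertex,
`τ = (x̄0², x̄1, x̄2, x̄3, x̄4)`, `I = τ̃|_{Spec 𝒪_{X,v}}`).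
* §1 generic `le_comap_algebraMap_of_mem` — in `R[I/a]`, a prime containing `a/1` contracts to a prime containing `I` (`x/1 = (x/a)·(a/1)`).
* §2 generic ★ `exists_point_over_centre_not_fullCl` — a prime `Q ∋ a/1` of `R[I/a]` at which `R[I/a]_Q` is NOT FULL gives a point `b ∈ Bl_I(Spec R)` over `V(I)` with
  `𝒪_{Bl,b}` NOT FULL (Rees chart `(R[It])_{(at)} ≅ R[I/a]` p622766, chart–stalk dictionary, `π ∘ (chart) = Spec (R → chart ring)` GW (13.19)).
* §3 generic ★ `exists_not_fullCl_of_isBlowup_comap_fromSpecStalk` — if a blowing up `B → X` along `J` has a NON-FULL stalk at a point over `x`, then EVERY blowing up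
  `g : S′ → Spec 𝒪_{X,x}` along `J|_{Spec 𝒪_{X,x}}` has a NON-FULL stalk at a point over the closed point (`S′ ≅ B ×_X Spec 𝒪_{X,x}`, pro-open stalks).
* §4 ★★ `tauFloor_not_full` — for EVERY blowing up `g : S′ → Spec 𝒪_{X,v}` along `I`: `∃ s : S′, g s = closed point ∧ ¬ FullCl 2 (𝒪_{S′,s})` (the point: the prime
  `(x̄, ȳ, z̄′)` of the `D(ȳ)` chart `C`, res-L1-w45a-stub-1 p617516/p622179; res-L1-w45a-stub-2's p615290 is the `D(x̄²)` twin). So the τ-floor is a legal input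
  (p624171) which is NOT an F(4)-iso input: the F-half has actual work to do there.
* §5 ★★★ `f4pos_row_one` — ROW #1 OF THE F(4)-pos LEDGER AS ONE KERNEL THEOREM: for every blowing up `g : S′ → Spec 𝒪_{X,v}` along `I`, (legal) the four `S′`-side
  binders of `LocalFInjectivizationFibreAdmGe4` hold ∧ (pos) some stalk of `S′` over the closed point is NOT FULL ∧ (cured) `∃ 𝓚 ≠ ⊥` on `S′` supported over the closed
  point ALL of whose blowings up are FULL at every stalk (res-L1-w45a-stub-3's `TauFloorP2d4CRow.tauFloor_P2d4C_row`, over res-L1-w45a-stub-2's certificate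
  `hrow_P2d4C` and res-L1-w45a-idea-1's `τ·K` fan).
[folklore assembly; cite: GortzWedhorn2020, (13.19), Prop. 13.91 (2)] [cite: StacksProject, Tag 0804; Tag 01J7] [cite: Temkin2008, §2.1]
-/

-- single-problem summit: the doubled namespace component is forced
set_option linter.dupNamespace false

noncomputable section

namespace Summit.ResolutionOfSingularities.ResolutionOfSingularities.Theorems.FInjectiveMacaulayfication.TauFloorInputNotFull

open CategoryTheory CategoryTheory.Limits AlgebraicGeometry TopologicalSpace IsLocalRing MvPolynomial
open Literature.AlgebraicGeometry.Resolution
open Summit.ResolutionOfSingularities.ResolutionOfSingularities.Theorems.FInjectiveMacaulayfication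
open SliceableCentre GermOfGlobalBlowup

/-! ## §1 Generic: primes of `R[I/a]` through `a/1` lie over `V(I)` -/

/-- In `R[I/a]`: a prime (indeed any ideal) containing `a/1` contracts to an ideal containing `I`, since `x/1 = (x/a)·(a/1)` for `x ∈ I`.
[folklore; cite: GortzWedhorn2020, (13.19) p. 415] -/
theorem le_comap_algebraMap_of_mem {R : Type} [CommRing R] (I : Ideal R) (a : R) (Q : Ideal (blowupAlgebra I a))
    (haQ : algebraMap R (blowupAlgebra I a) a ∈ Q) : I ≤ Q.comap (algebraMap R (blowupAlgebra I a)) := by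
  intro x hx
  rw [Ideal.mem_comap]
  have hxa : algebraMap R (blowupAlgebra I a) x = ⟨_, div_mem_blowupAlgebra I a hx⟩ * algebraMap R (blowupAlgebra I a) a :=
    Subtype.ext (by simp only [Subalgebra.coe_algebraMap, Subalgebra.coe_mul, div_mul_algebraMap])
  rw [hxa]
  exact Q.mul_mem_left _ haQ

/-! ## §2 Generic: a NON-FULL prime of `R[I/a]` through `a/1` gives a NON-FULL stalk of `Bl_I(Spec R)` over `V(I)` -/

/-- Transport of a NON-FULL prime along a ring isomorphism onto the blow-up algebra (variable-typed, to keep the instance paths of the Rees chart ring out of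
`Ideal.comap`). [plumbing] -/
theorem exists_prime_not_fullCl_of_ringEquiv {T B₁ : Type} [CommRing T] [CommRing B₁] (p : ℕ) (e : T ≃+* B₁) (Q : Ideal B₁) [Q.IsPrime]
    (hbad : ¬ FullCl p (Localization.AtPrime Q)) :
    ∃ q : PrimeSpectrum T, (∀ t : T, t ∈ q.asIdeal ↔ e t ∈ Q) ∧ ¬ FullCl p (Localization.AtPrime q.asIdeal) := by
  haveI : (Q.comap e.toRingHom).IsPrime := Ideal.IsPrime.comap _
  obtain ⟨eQ⟩ := E8Char5FiModel.nonempty_ringEquiv_localization_comap e Q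
  exact ⟨⟨Q.comap e.toRingHom, inferInstance⟩, fun t => Iff.rfl, fun h => hbad (WFixAtNonClosedDimTwo.fullCl_of_ringEquiv p eQ h)⟩

/-- ★ **A point of the blowing up over the centre with a NON-FULL stalk, from the affine blow-up algebra.** If `Q ∋ a/1` is a prime of `R[I/a]` with `R[I/a]_Q` NOT
FULL, then some `b ∈ Bl_I(Spec R) = affineBlowup I` with `π b ⊇ I` has `𝒪_{Bl,b}` NOT FULL: transport `Q` to the Rees chart `(R[It])_{(at)} ≅ R[I/a]`
(`ReesChartFacts.exists_reesChartEquiv`), take `b` = its image under the chart immersion, whose stalk is the local ring of the chart (`nonempty_stalkAwayιEquiv`) and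
whose image in `Spec R` is the contraction along `R → (R[It])_{(at)}` (`affineBlowup.π_awayι_reesT_apply`). [folklore; cite: GortzWedhorn2020, (13.19)]
[cite: StacksProject, Tag 0804] -/
theorem exists_point_over_centre_not_fullCl {R : Type} [CommRing R] (I : Ideal R) (a : R) (ha : a ∈ I) (p : ℕ)
    (Q : Ideal (blowupAlgebra I a)) [Q.IsPrime] (haQ : algebraMap R (blowupAlgebra I a) a ∈ Q) (hbad : ¬ FullCl p (Localization.AtPrime Q)) :
    ∃ b : ↥(affineBlowup I), I ≤ ((affineBlowup.π I).base b).asIdeal ∧ ¬ FullCl p ((affineBlowup I).presheaf.stalk b) := by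
  obtain ⟨e, he⟩ := ReesChartFacts.exists_reesChartEquiv I a ha
  obtain ⟨q, hq, hqbad⟩ := exists_prime_not_fullCl_of_ringEquiv (T := HomogeneousLocalization.Away (reesGrading I) (reesT a ha)) p e Q hbad
  obtain ⟨es⟩ := AffineBlowupStalkNotClause.nonempty_stalkAwayιEquiv a ha q
  refine ⟨(Proj.awayι (reesGrading I) (reesT a ha) (reesT_mem a ha) Nat.one_pos).base q, ?_, ?_⟩
  · -- `π b = q ∩ R = Q ∩ R ⊇ I`
    intro x hx
    have hπ := affineBlowup.π_awayι_reesT_apply (I := I) a ha q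
    change x ∈ (affineBlowup.π I (Proj.awayι (reesGrading I) (reesT a ha) (reesT_mem a ha) Nat.one_pos q)).asIdeal
    rw [hπ, PrimeSpectrum.comap_asIdeal, Ideal.mem_comap, hq, he]
    exact le_comap_algebraMap_of_mem I a Q haQ hx
  · -- the stalk is `(chart ring)_q`, NOT FULL
    intro hfull
    exact hqbad (WFixAtNonClosedDimTwo.fullCl_of_ringEquiv p es hfull)

/-! ## §3 Generic: a NON-FULL stalk over `x` survives to every local blowing up along `J|_{Spec 𝒪_{X,x}}` -/

/-- ★ **NON-FULL stalks over `x` pass to every blowing up of `Spec 𝒪_{X,x}` along the induced centre.** If `π_B : B → X` is a blowing up along `J` and `𝒪_{B,b}` is NOT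
FULL for some `b` over `x`, then every blowing up `g : S′ → Spec 𝒪_{X,x}` along `J|_{Spec 𝒪_{X,x}}` has a point `s` over the closed point with `𝒪_{S′,s}` NOT FULL:
`S′ ≅ B ×_X Spec 𝒪_{X,x}` (uniqueness, flat base change), `b` lies in the image of the pro-open pro-subscheme (`mem_range_pullback_fst_fromSpecStalk_of_eq`), whose stalks
are those of `B`. [folklore assembly; cite: GortzWedhorn2020, Prop. 13.91 (2), (13.19)] [cite: Temkin2008, §2.1] [cite: StacksProject, Tag 01J7] -/
theorem exists_not_fullCl_of_isBlowup_comap_fromSpecStalk (p : ℕ) {X B : Scheme.{0}} (x : X) {πB : B ⟶ X} {J : X.IdealSheafData} (hB : IsBlowup πB J)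
    (hbad : ∃ b : B, πB.base b = x ∧ ¬ FullCl p (B.presheaf.stalk b))
    {S' : Scheme.{0}} {g : S' ⟶ Spec (X.presheaf.stalk x)} (hg : IsBlowup g (J.comap (X.fromSpecStalk x))) :
    ∃ s : S', g.base s = closedPoint (X.presheaf.stalk x) ∧ ¬ FullCl p (S'.presheaf.stalk s) := by
  haveI : Flat (X.fromSpecStalk x) := flat_fromSpecStalk X x
  have hP := hB.pullback_snd_of_flat (X.fromSpecStalk x)
  obtain ⟨e, -, he⟩ := hg.unique hP
  obtain ⟨b, hb, hbadb⟩ := hbad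
  obtain ⟨t, ht⟩ := mem_range_pullback_fst_fromSpecStalk_of_eq (π := πB) (x := x) hb
  refine ⟨e.inv.base t, ?_, ?_⟩
  · -- over the closed point: `ι (snd t) = π_B (fst t) = π_B b = x`
    have hgs : g.base (e.inv.base t) = (pullback.snd πB (X.fromSpecStalk x)).base t := by
      rw [← he]; rfl
    have hcond : πB.base ((pullback.fst πB (X.fromSpecStalk x)).base t) = (X.fromSpecStalk x).base ((pullback.snd πB (X.fromSpecStalk x)).base t) :=
      congrArg (fun φ => φ.base t) (pullback.condition (f := πB) (g := X.fromSpecStalk x))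
    rw [hgs]
    refine eq_closedPoint_of_fromSpecStalk_eq x _ ?_
    rw [← hcond, ht, hb]
  · -- stalks: `𝒪_{S′, e⁻¹ t} ≅ 𝒪_{P,t} ≅ 𝒪_{B, fst t} = 𝒪_{B,b}`
    intro hfull
    haveI := isIso_stalkMap_of_flat_of_isPreimmersion e.inv t
    haveI := isIso_stalkMap_pullback_fst_fromSpecStalk πB x t
    have h1 : FullCl p ((pullback πB (X.fromSpecStalk x)).presheaf.stalk t) := FTemkinClosedPoints.fullCl_of_isIso_stalkMap' p e.inv t hfull
    have h2 : FullCl p (B.presheaf.stalk ((pullback.fst πB (X.fromSpecStalk x)).base t)) :=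
      WFixAtNonClosedDimTwo.fullCl_of_ringEquiv p (asIso ((pullback.fst πB (X.fromSpecStalk x)).stalkMap t)).commRingCatIsoToRingEquiv.symm h1
    apply hbadb
    change FullCl p (B.presheaf.stalk ((pullback.fst πB (X.fromSpecStalk x)) t)) at h2
    rwa [ht] at h2

/-! ## §4 The τ-floor is NOT F(4)-iso -/

/-- ★ **A point of `Bl_τ X` over the vertex with a NON-FULL stalk**: the prime `(x̄, ȳ, z̄′)` of the `D(ȳ)` chart `C ≅ A₀[τ/ȳ]` (p620521, p617516, p622179).
[OURS · assembly of landed chart facts] -/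
theorem exists_point_over_vertex_not_fullCl (k : Type) [Field k] [CharP k 2] (f : MvPolynomial (Fin 5) k)
    (hf : f = X 4 ^ 2 + X 0 ^ 4 * X 4 + X 1 ^ 3 + X 2 ^ 3 + X 3 ^ 3)
    (v : Spec (.of (MvPolynomial (Fin 5) k ⧸ Ideal.span {f})))
    (hv : v.asIdeal = Ideal.span (Set.range fun j : Fin 5 => Ideal.Quotient.mk (Ideal.span {f}) (X j))) :
    ∃ b : ↥(affineBlowup (Ideal.span {Ideal.Quotient.mk (Ideal.span {f}) (X 0) ^ 2, Ideal.Quotient.mk (Ideal.span {f}) (X 1),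
        Ideal.Quotient.mk (Ideal.span {f}) (X 2), Ideal.Quotient.mk (Ideal.span {f}) (X 3), Ideal.Quotient.mk (Ideal.span {f}) (X 4)} :
          Ideal (MvPolynomial (Fin 5) k ⧸ Ideal.span {f}))),
      (affineBlowup.π _).base b = v ∧ ¬ FullCl 2 ((affineBlowup (Ideal.span {Ideal.Quotient.mk (Ideal.span {f}) (X 0) ^ 2,
        Ideal.Quotient.mk (Ideal.span {f}) (X 1), Ideal.Quotient.mk (Ideal.span {f}) (X 2), Ideal.Quotient.mk (Ideal.span {f}) (X 3),
        Ideal.Quotient.mk (Ideal.span {f}) (X 4)} : Ideal (MvPolynomial (Fin 5) k ⧸ Ideal.span {f}))).presheaf.stalk b) := by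
  classical
  -- the `D(ȳ)` chart: `C ≅ A₀[τ/ȳ]`, and the prime `P₀ = (x̄, ȳ, z̄′)` of `C`
  obtain ⟨e, he⟩ := TauFloorOneCIChartIdent.exists_chartEquiv k f hf (X 0 ^ 2 - X 2 * X 1) (X 5 ^ 2 + X 1 * (1 + X 2 ^ 2 * X 5 + X 3 ^ 3 + X 4 ^ 3)) rfl rfl
  haveI hP₀ := TauFloorOneCIChartNotFull.primeXYZ_isPrime k (X 0 ^ 2 - X 2 * X 1) (X 5 ^ 2 + X 1 * (1 + X 2 ^ 2 * X 5 + X 3 ^ 3 + X 4 ^ 3)) rfl rfl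
  set Q := (Ideal.span ({Ideal.Quotient.mk (Ideal.span {(X 0 ^ 2 - X 2 * X 1 : MvPolynomial (Fin 6) k), X 5 ^ 2 + X 1 * (1 + X 2 ^ 2 * X 5 + X 3 ^ 3 + X 4 ^ 3)}) (X 0),
      Ideal.Quotient.mk (Ideal.span {(X 0 ^ 2 - X 2 * X 1 : MvPolynomial (Fin 6) k), X 5 ^ 2 + X 1 * (1 + X 2 ^ 2 * X 5 + X 3 ^ 3 + X 4 ^ 3)}) (X 1),
      Ideal.Quotient.mk (Ideal.span {(X 0 ^ 2 - X 2 * X 1 : MvPolynomial (Fin 6) k), X 5 ^ 2 + X 1 * (1 + X 2 ^ 2 * X 5 + X 3 ^ 3 + X 4 ^ 3)}) (X 5)} :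
        Set (MvPolynomial (Fin 6) k ⧸ Ideal.span {(X 0 ^ 2 - X 2 * X 1 : MvPolynomial (Fin 6) k), X 5 ^ 2 + X 1 * (1 + X 2 ^ 2 * X 5 + X 3 ^ 3 + X 4 ^ 3)}))).comap
    e.symm.toRingHom with hQ
  haveI : Q.IsPrime := Ideal.IsPrime.comap _
  -- `ȳ/1 ∈ Q` since `e (ȳ_C) = ȳ/1`
  have hy : Ideal.Quotient.mk (Ideal.span {f}) (X 1 : MvPolynomial (Fin 5) k) ∈
      (Ideal.span {Ideal.Quotient.mk (Ideal.span {f}) (X 0) ^ 2, Ideal.Quotient.mk (Ideal.span {f}) (X 1),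
        Ideal.Quotient.mk (Ideal.span {f}) (X 2), Ideal.Quotient.mk (Ideal.span {f}) (X 3), Ideal.Quotient.mk (Ideal.span {f}) (X 4)} :
          Ideal (MvPolynomial (Fin 5) k ⧸ Ideal.span {f})) := Ideal.subset_span (by simp)
  have hey : e (Ideal.Quotient.mk _ (X 1)) = algebraMap (MvPolynomial (Fin 5) k ⧸ Ideal.span {f}) _ (Ideal.Quotient.mk (Ideal.span {f}) (X 1)) :=
    Subtype.ext (he 1)
  have hyQ : algebraMap (MvPolynomial (Fin 5) k ⧸ Ideal.span {f}) _ (Ideal.Quotient.mk (Ideal.span {f}) (X 1)) ∈ Q := by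
    rw [hQ, Ideal.mem_comap, RingEquiv.toRingHom_eq_coe, RingEquiv.coe_toRingHom, ← hey, RingEquiv.symm_apply_apply]
    exact Ideal.subset_span (by simp)
  obtain ⟨b, hb, hbad⟩ := exists_point_over_centre_not_fullCl _ _ hy 2 Q hyQ
    (TauFloorOneChartYTransport.not_fullCl_localization_blowupAlgebra k f hf Q hyQ)
  refine ⟨b, ?_, hbad⟩
  -- `π b ⊇ τ ⊇ 𝔪_v²`-ish, so `π b = v` (`𝔪_v` maximal)
  haveI hmax : v.asIdeal.IsMaximal := by
    rw [hv]; exact DoublePointFermatCubicGerm.isMaximal_origin k f (FCentreE1ChartWitness.constantCoeff_f k f hf)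
  have h1 : v.asIdeal ≤ ((affineBlowup.π _).base b).asIdeal := by
    rw [hv, Ideal.span_le]
    rintro _ ⟨j, rfl⟩
    have hx0 : Ideal.Quotient.mk (Ideal.span {f}) (X 0) ∈ ((affineBlowup.π _).base b).asIdeal :=
      ((affineBlowup.π _).base b).2.mem_of_pow_mem 2 (hb (Ideal.subset_span (by simp)))
    fin_cases j
    · exact hx0
    · exact hb (Ideal.subset_span (by simp))
    · exact hb (Ideal.subset_span (by simp))
    · exact hb (Ideal.subset_span (by simp))
    · exact hb (Ideal.subset_span (by simp))
  exact (PrimeSpectrum.ext (hmax.eq_of_le ((affineBlowup.π _).base b).2.ne_top h1)).symm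

/-- ★★ **F4POS-1 (e): the τ-floor is NOT an F(4)-iso input.** For EVERY blowing up `g : S′ → Spec 𝒪_{X,v}` along `I = τ̃|_{Spec 𝒪_{X,v}}` there is a point `s ∈ S′` over the
closed point whose local ring is NOT FULL. [OURS · assembly; cite: GortzWedhorn2020, Prop. 13.91 (2)] [cite: Temkin2008, §2.1] -/
theorem tauFloor_not_full (k : Type) [Field k] [CharP k 2] (f : MvPolynomial (Fin 5) k)
    (hf : f = X 4 ^ 2 + X 0 ^ 4 * X 4 + X 1 ^ 3 + X 2 ^ 3 + X 3 ^ 3)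
    (v : Spec (.of (MvPolynomial (Fin 5) k ⧸ Ideal.span {f})))
    (hv : v.asIdeal = Ideal.span (Set.range fun j : Fin 5 => Ideal.Quotient.mk (Ideal.span {f}) (X j)))
    (S' : Scheme.{0}) (g : S' ⟶ Spec ((Spec (.of (MvPolynomial (Fin 5) k ⧸ Ideal.span {f}))).presheaf.stalk v))
    (hg : IsBlowup g ((affineBlowup.idealSheaf
        (Ideal.span {Ideal.Quotient.mk (Ideal.span {f}) (X 0) ^ 2, Ideal.Quotient.mk (Ideal.span {f}) (X 1),
          Ideal.Quotient.mk (Ideal.span {f}) (X 2), Ideal.Quotient.mk (Ideal.span {f}) (X 3), Ideal.Quotient.mk (Ideal.span {f}) (X 4)})).comap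
        ((Spec (.of (MvPolynomial (Fin 5) k ⧸ Ideal.span {f}))).fromSpecStalk v))) :
    ∃ s : S', g.base s = closedPoint ((Spec (.of (MvPolynomial (Fin 5) k ⧸ Ideal.span {f}))).presheaf.stalk v) ∧ ¬ FullCl 2 (S'.presheaf.stalk s) :=
  exists_not_fullCl_of_isBlowup_comap_fromSpecStalk 2 v (affineBlowup.isBlowup _) (exists_point_over_vertex_not_fullCl k f hf v hv) hg

/-! ## §5 Row #1 of the F(4)-pos ledger as one theorem -/

/-- ★★★ **ROW #1 (P2d4C τ-floor; char 2, any field) AS ONE KERNEL THEOREM: LEGAL ∧ NOT F(4)-iso ∧ CURED.** For every blowing up `g : S′ → Spec 𝒪_{X,v}` along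
`I = τ̃|_{Spec 𝒪_{X,v}}`: (legal, p624171) `I ≠ ⊥`, `Supp I ⊆ (Reg)ᶜ`, `S′` regular off the closed fibre and CM everywhere; (pos, §4) some stalk of `S′` over the closed point is
NOT FULL; (cured, res-L1-w45a-stub-3's `tauFloor_P2d4C_row` over res-L1-w45a-stub-2's certificate) there is `𝓚 ≠ ⊥` on `S′`, supported over the closed point, ALL of
whose blowings up are FULL at every stalk. [OURS · assembly of landed theorems] -/
theorem f4pos_row_one (k : Type) [Field k] [CharP k 2] (f : MvPolynomial (Fin 5) k)
    (hf : f = X 4 ^ 2 + X 0 ^ 4 * X 4 + X 1 ^ 3 + X 2 ^ 3 + X 3 ^ 3)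
    (v : Spec (.of (MvPolynomial (Fin 5) k ⧸ Ideal.span {f})))
    (hv : v.asIdeal = Ideal.span (Set.range fun j : Fin 5 => Ideal.Quotient.mk (Ideal.span {f}) (X j)))
    (S' : Scheme.{0}) (g : S' ⟶ Spec ((Spec (.of (MvPolynomial (Fin 5) k ⧸ Ideal.span {f}))).presheaf.stalk v))
    (hg : IsBlowup g ((affineBlowup.idealSheaf
        (Ideal.span {Ideal.Quotient.mk (Ideal.span {f}) (X 0) ^ 2, Ideal.Quotient.mk (Ideal.span {f}) (X 1),
          Ideal.Quotient.mk (Ideal.span {f}) (X 2), Ideal.Quotient.mk (Ideal.span {f}) (X 3), Ideal.Quotient.mk (Ideal.span {f}) (X 4)})).comap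
        ((Spec (.of (MvPolynomial (Fin 5) k ⧸ Ideal.span {f}))).fromSpecStalk v))) :
    ((affineBlowup.idealSheaf
        (Ideal.span {Ideal.Quotient.mk (Ideal.span {f}) (X 0) ^ 2, Ideal.Quotient.mk (Ideal.span {f}) (X 1),
          Ideal.Quotient.mk (Ideal.span {f}) (X 2), Ideal.Quotient.mk (Ideal.span {f}) (X 3), Ideal.Quotient.mk (Ideal.span {f}) (X 4)})).comap
        ((Spec (.of (MvPolynomial (Fin 5) k ⧸ Ideal.span {f}))).fromSpecStalk v) ≠ ⊥ ∧
    ((((affineBlowup.idealSheaf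
        (Ideal.span {Ideal.Quotient.mk (Ideal.span {f}) (X 0) ^ 2, Ideal.Quotient.mk (Ideal.span {f}) (X 1),
          Ideal.Quotient.mk (Ideal.span {f}) (X 2), Ideal.Quotient.mk (Ideal.span {f}) (X 3), Ideal.Quotient.mk (Ideal.span {f}) (X 4)})).comap
        ((Spec (.of (MvPolynomial (Fin 5) k ⧸ Ideal.span {f}))).fromSpecStalk v)).support :
          Set (Spec ((Spec (.of (MvPolynomial (Fin 5) k ⧸ Ideal.span {f}))).presheaf.stalk v))) ⊆
      (Scheme.regularLocus (Spec ((Spec (.of (MvPolynomial (Fin 5) k ⧸ Ideal.span {f}))).presheaf.stalk v)))ᶜ) ∧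
    (∀ s : S', g.base s ≠ closedPoint ((Spec (.of (MvPolynomial (Fin 5) k ⧸ Ideal.span {f}))).presheaf.stalk v) → s ∈ Scheme.regularLocus S') ∧
    (∀ s : S', CMCl (S'.presheaf.stalk s))) ∧
    (∃ s : S', g.base s = closedPoint ((Spec (.of (MvPolynomial (Fin 5) k ⧸ Ideal.span {f}))).presheaf.stalk v) ∧ ¬ FullCl 2 (S'.presheaf.stalk s)) ∧
    (∃ 𝓚 : S'.IdealSheafData, 𝓚 ≠ ⊥ ∧
      (∀ s ∈ (𝓚.support : Set S'), g.base s = closedPoint ((Spec (.of (MvPolynomial (Fin 5) k ⧸ Ideal.span {f}))).presheaf.stalk v)) ∧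
      ∀ (S'' : Scheme.{0}) (π : S'' ⟶ S'), IsBlowup π 𝓚 → ∀ s : S'', FullCl 2 (S''.presheaf.stalk s)) :=
  ⟨TauFloorInputLegal.tauFloor_input_legal k f hf v hv S' g hg, tauFloor_not_full k f hf v hv S' g hg,
    TauFloorP2d4CRow.tauFloor_P2d4C_row k f hf v hv S' g hg⟩

end Summit.ResolutionOfSingularities.ResolutionOfSingularities.Theorems.FInjectiveMacaulayfication.TauFloorInputNotFull

end
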